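import Literature.Analysis.FluidPDE.RdssPeriodConcatenation
import Literature.Analysis.FluidPDE.TaoQuantitativeTotalSpeed
import HarnessLib

/-!
# Concatenation of a cell along the zoom — crux stmt-NavierStokesRegularity-1404
  (`QuantisedSymmetry.PolyhedralDssProfileExists`), line polyhedral_cell, stub stub_cellConcatenation

Registered stub `stub_cellConcatenation` (`--supports stmt-NavierStokesRegularity-1404`). Given a
`G`-cell `v` on the model period `[-1, -c⁻²]` (`c > 1`: jointly continuous, bounded, weakly
divergence free, Oseen-mild between all pairs of model times, closing up under the zoom
`v(-c⁻², x) = c v(-1, cx)`, `G`-equivariant slice by slice), the two-sided ℤ-concatenation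

  `u(t, x) = c⁻ᵏ v(c⁻²ᵏ t, c⁻ᵏ x)` on the slab `t ∈ [-(c²)ᵏ, -(c²)ᵏ⁻¹]`, `k ∈ ℤ`, `u = 0` for `t ≥ 0`,

is well defined (the two formulas agree at the junction times by the zoom condition), jointly
continuous and Oseen-mild slab by slab (zoom covariance of the Oseen integral equation,
`oseen_zoom`), has weakly divergence-free slices (`isWeaklyDivFree_zoom_in`), is exactly `c`-DSS,
`G`-equivariant, has `u(-1) = v(-1)`, and obeys the Type-I time rate `‖u(t,x)‖ ≤ M/√(-t)` with
the cell's bound `M`.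

The slab index of a negative time exists by `exists_mem_Ioc_zpow` (`(c²)ᵏ⁻¹ < -t ≤ (c²)ᵏ`) and is
unique by strict monotonicity of `k ↦ (c²)ᵏ`; all statements below are about an arbitrary index
function `κ` with this property, so that the file declares theorems only.
-/

noncomputable section

-- the summit namespace `…NavierStokesRegularity.NavierStokesRegularity…` is the tree convention (D-0017)
set_option linter.dupNamespace false

namespace Summit.NavierStokesRegularity.NavierStokesRegularity.Theorems.PolyhedralDssProfileExists.PolyhedralCell

open MeasureTheory Set Function Filter Topology
open Literature.Analysis Literature.Analysis.FluidPDE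

/-! ### The slab index of a negative time -/

/-- Every negative time lies in a slab: for `q > 1` and `t < 0` there is `k : ℤ` with
`q^(k-1) < -t ≤ q^k`. -/
theorem exists_slabIdx {q t : ℝ} (hq : 1 < q) (ht : t < 0) :
    ∃ k : ℤ, q ^ (k - 1) < -t ∧ -t ≤ q ^ k := by
  obtain ⟨n, hn1, hn2⟩ := exists_mem_Ioc_zpow (neg_pos.2 ht) hq
  exact ⟨n + 1, by rwa [add_sub_cancel_right], hn2⟩

/-- The slab index is unique (strict monotonicity of `k ↦ q^k`). -/
theorem slabIdx_unique {q t : ℝ} (hq : 1 < q) {k k' : ℤ} (h1 : q ^ (k - 1) < -t) (h2 : -t ≤ q ^ k)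
    (h1' : q ^ (k' - 1) < -t) (h2' : -t ≤ q ^ k') : k = k' := by
  have h5 : q ^ (k - 1) < q ^ k' := h1.trans_le h2'
  have h6 : q ^ (k' - 1) < q ^ k := h1'.trans_le h2
  rw [zpow_lt_zpow_iff_right₀ hq] at h5 h6
  omega

/-! ### Zoom algebra: the factors `c⁻ᵏ = c ^ (-k)` -/

/-- `0 < c⁻ᵏ`. -/
theorem zoom_pos {c : ℝ} (hc : 0 < c) (k : ℤ) : 0 < c ^ (-k) := zpow_pos hc _

/-- `(c⁻ᵏ)² · (c²)ᵏ = 1`. -/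
theorem zoom_sq_mul {c : ℝ} (hc : 0 < c) (k : ℤ) : (c ^ (-k)) ^ 2 * (c ^ 2) ^ k = 1 := by
  have hck : c ^ k ≠ 0 := (zpow_pos hc k).ne'
  rw [show c ^ 2 = c * c from sq c, mul_zpow, zpow_neg, sq]
  field_simp

/-- `(c⁻ᵏ)² · (c²)ᵏ⁻¹ = c⁻²`. -/
theorem zoom_sq_mul_pred {c : ℝ} (hc : 0 < c) (k : ℤ) :
    (c ^ (-k)) ^ 2 * (c ^ 2) ^ (k - 1) = (c ^ 2)⁻¹ := by
  have hc2 : (c ^ 2 : ℝ) ≠ 0 := by positivity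
  rw [zpow_sub_one₀ hc2, ← mul_assoc, zoom_sq_mul hc k, one_mul]

/-- `c⁻⁽ᵏ⁺¹⁾ · c = c⁻ᵏ`. -/
theorem zoom_succ_mul {c : ℝ} (hc : 0 < c) (k : ℤ) : c ^ (-(k + 1)) * c = c ^ (-k) := by
  rw [zpow_neg, zpow_neg, zpow_add_one₀ hc.ne']
  field_simp

/-- `√((c²)ᵏ) · c⁻ᵏ = 1`, i.e. `√((c²)ᵏ) = cᵏ`. -/
theorem sqrt_zpow_sq_mul_zoom {c : ℝ} (hc : 0 < c) (k : ℤ) : Real.sqrt ((c ^ 2) ^ k) * c ^ (-k) = 1 := by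
  have h1 : (c ^ 2) ^ k = (c ^ k) ^ 2 := by
    rw [show c ^ 2 = c * c from sq c, mul_zpow, sq]
  rw [h1, Real.sqrt_sq (zpow_pos hc k).le, zpow_neg, mul_inv_cancel₀ (zpow_pos hc k).ne']

/-- **Model times.** On the slab `-(c²)ᵏ ≤ t ≤ -(c²)ᵏ⁻¹` the rescaled time `(c⁻ᵏ)² t` lies in the
model period `[-1, -c⁻²]`. -/
theorem zoom_time_mem {c : ℝ} (hc : 0 < c) (k : ℤ) {t : ℝ} (h1 : -((c ^ 2) ^ k) ≤ t)
    (h2 : t ≤ -((c ^ 2) ^ (k - 1))) :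
    (c ^ (-k)) ^ 2 * t ∈ Icc (-1 : ℝ) (-(c ^ 2)⁻¹) := by
  have ha : 0 ≤ (c ^ (-k)) ^ 2 := sq_nonneg _
  constructor
  · have := mul_le_mul_of_nonneg_left h1 ha
    rwa [mul_neg, zoom_sq_mul hc k] at this
  · have := mul_le_mul_of_nonneg_left h2 ha
    rwa [mul_neg, zoom_sq_mul_pred hc k] at this

/-- Strict version at the left end: `-(c²)ᵏ ≤ s < t` gives `(c⁻ᵏ)² s < (c⁻ᵏ)² t`. -/
theorem zoom_time_lt {c : ℝ} (hc : 0 < c) (k : ℤ) {s t : ℝ} (hst : s < t) :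
    (c ^ (-k)) ^ 2 * s < (c ^ (-k)) ^ 2 * t :=
  mul_lt_mul_of_pos_left hst (pow_pos (zoom_pos hc k) 2)


/-! ### The concatenated field on one slab -/

variable {c : ℝ} {v : ℝ → EuclideanSpace ℝ (Fin 3) → EuclideanSpace ℝ (Fin 3)} {κ : ℝ → ℤ}

/-- **The slab formula.** Let `κ` assign to every negative time a slab index
(`(c²)^(κ t - 1) < -t ≤ (c²)^(κ t)`) and let `v` satisfy the zoom condition
`v(-c⁻², x) = c v(-1, cx)`. Then the concatenated field
`u(t, x) = c^(-κ t) v((c^(-κ t))² t, c^(-κ t) x)` (`t < 0`) is given on the WHOLE closed slab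
`[-(c²)ᵏ, -(c²)ᵏ⁻¹]` by the formula with index `k` — at the right end point `t = -(c²)ᵏ⁻¹`, where
`κ t = k - 1`, the two formulas agree by the zoom condition. -/
theorem concat_eq_zoom (hc : 1 < c) (hjump : ∀ x, v (-(c ^ 2)⁻¹) x = c • v (-1) (c • x))
    (hκ : ∀ t < 0, (c ^ 2) ^ (κ t - 1) < -t ∧ -t ≤ (c ^ 2) ^ (κ t))
    {k : ℤ} {t : ℝ} (h1 : -((c ^ 2) ^ k) ≤ t) (h2 : t ≤ -((c ^ 2) ^ (k - 1)))
    (x : EuclideanSpace ℝ (Fin 3)) :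
    (if t < 0 then c ^ (-κ t) • v ((c ^ (-κ t)) ^ 2 * t) (c ^ (-κ t) • x) else 0) =
      c ^ (-k) • v ((c ^ (-k)) ^ 2 * t) (c ^ (-k) • x) := by
  have hc0 : 0 < c := one_pos.trans hc
  have hq : 1 < c ^ 2 := by nlinarith
  have hq0 : 0 < c ^ 2 := by positivity
  have hqk1 : 0 < (c ^ 2) ^ (k - 1) := zpow_pos hq0 _
  have ht : t < 0 := by linarith
  rw [if_pos ht]
  rcases h2.lt_or_eq with hlt | heq
  · -- interior or left end: the index is `k`
    have hk : κ t = k :=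
      slabIdx_unique hq (hκ t ht).1 (hκ t ht).2 (by linarith) (by linarith)
    rw [hk]
  · -- right end point `t = -(c²)^(k-1)`: the index is `k - 1`; use the zoom condition
    have hk : κ t = k - 1 := by
      refine slabIdx_unique hq (hκ t ht).1 (hκ t ht).2 ?_ (by linarith)
      have : (c ^ 2) ^ (k - 1 - 1) < (c ^ 2) ^ (k - 1) := zpow_lt_zpow_right₀ hq (by linarith)
      linarith
    rw [hk]
    -- `b = c^{-(k-1)}`, `a = c^{-k}`, `a c = b`
    have hab : c ^ (-k) * c = c ^ (-(k - 1)) := by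
      have := zoom_succ_mul hc0 (k - 1)
      rwa [sub_add_cancel] at this
    have hbt : (c ^ (-(k - 1))) ^ 2 * t = -1 := by
      rw [heq, mul_neg, zoom_sq_mul hc0 (k - 1)]
    have hat : (c ^ (-k)) ^ 2 * t = -(c ^ 2)⁻¹ := by
      rw [heq, mul_neg, zoom_sq_mul_pred hc0 k]
    rw [hbt, hat, hjump, smul_smul, smul_smul, mul_comm c (c ^ (-k)), hab]

/-- **Joint continuity on a slab** of the zoomed cell `(t, x) ↦ c⁻ᵏ v((c⁻ᵏ)²t, c⁻ᵏx)`. -/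
theorem continuousOn_zoom_slab (hc : 0 < c)
    (hvcont : ContinuousOn (Function.uncurry v) (Set.Icc (-1 : ℝ) (-(c ^ 2)⁻¹) ×ˢ Set.univ)) (k : ℤ) :
    ContinuousOn (fun p : ℝ × EuclideanSpace ℝ (Fin 3) =>
        c ^ (-k) • v ((c ^ (-k)) ^ 2 * p.1) (c ^ (-k) • p.2))
      (Set.Icc (-((c ^ 2) ^ k)) (-((c ^ 2) ^ (k - 1))) ×ˢ Set.univ) := by
  have hΨ : Continuous fun p : ℝ × EuclideanSpace ℝ (Fin 3) =>
      ((c ^ (-k)) ^ 2 * p.1, c ^ (-k) • p.2) :=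
    (continuous_const.mul continuous_fst).prodMk (continuous_snd.const_smul (c ^ (-k)))
  have hmaps : MapsTo (fun p : ℝ × EuclideanSpace ℝ (Fin 3) => ((c ^ (-k)) ^ 2 * p.1, c ^ (-k) • p.2))
      (Set.Icc (-((c ^ 2) ^ k)) (-((c ^ 2) ^ (k - 1))) ×ˢ Set.univ)
      (Set.Icc (-1 : ℝ) (-(c ^ 2)⁻¹) ×ˢ Set.univ) :=
    fun p hp => ⟨zoom_time_mem hc k hp.1.1 hp.1.2, mem_univ _⟩
  exact (hvcont.comp hΨ.continuousOn hmaps).const_smul (c ^ (-k))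

/-- **The Oseen equation on a slab** for the zoomed cell: if `v` is Oseen-mild between all pairs of
model times, then `(t, x) ↦ c⁻ᵏ v((c⁻ᵏ)²t, c⁻ᵏx)` is Oseen-mild between all pairs of times of the
slab `[-(c²)ᵏ, -(c²)ᵏ⁻¹]` (zoom covariance `oseen_zoom` with factor `c⁻ᵏ` and the identity
isometry). -/
theorem oseenMild_zoom_slab (hc : 0 < c)
    (hvmild : ∀ s t : ℝ, -1 ≤ s → s < t → t ≤ -(c ^ 2)⁻¹ → ∀ x,
      v t x = heatFlow (v s) (t - s) x - oseenDuhamel 1 s v v t x)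
    (k : ℤ) {s t : ℝ} (hs : -((c ^ 2) ^ k) ≤ s) (hst : s < t) (ht : t ≤ -((c ^ 2) ^ (k - 1)))
    (x : EuclideanSpace ℝ (Fin 3)) :
    c ^ (-k) • v ((c ^ (-k)) ^ 2 * t) (c ^ (-k) • x) =
      heatFlow (fun y => c ^ (-k) • v ((c ^ (-k)) ^ 2 * s) (c ^ (-k) • y)) (t - s) x -
        oseenDuhamel 1 s (fun τ y => c ^ (-k) • v ((c ^ (-k)) ^ 2 * τ) (c ^ (-k) • y))
          (fun τ y => c ^ (-k) • v ((c ^ (-k)) ^ 2 * τ) (c ^ (-k) • y)) t x := by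
  set a : ℝ := c ^ (-k) with ha_def
  have ha : 0 < a := zoom_pos hc k
  have hσ : -1 ≤ a ^ 2 * s := (zoom_time_mem hc k hs (hst.le.trans ht)).1
  have hτ : a ^ 2 * t ≤ -(c ^ 2)⁻¹ := (zoom_time_mem hc k (hs.trans hst.le) ht).2
  have hστ : a ^ 2 * s < a ^ 2 * t := zoom_time_lt hc k hst
  have hf : ∀ X, v (a ^ 2 * t) X =
      UnboundedOperators.heatExtension (v (a ^ 2 * s)) (a ^ 2 * t - a ^ 2 * s) X -
        oseenDuhamel 1 (a ^ 2 * s) v v (a ^ 2 * t) X := by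
    intro X
    rw [← heatFlow_of_pos _ (sub_pos.2 hστ)]
    exact hvmild _ _ hσ hστ hτ X
  have key := oseen_zoom ha (LinearIsometryEquiv.refl ℝ (EuclideanSpace ℝ (Fin 3))) hst hf x
  have e : (LinearIsometryEquiv.refl ℝ (EuclideanSpace ℝ (Fin 3))).symm =
      LinearIsometryEquiv.refl ℝ (EuclideanSpace ℝ (Fin 3)) := rfl
  simp only [e, LinearIsometryEquiv.coe_refl, id_eq] at key
  rw [heatFlow_of_pos _ (sub_pos.2 hst)]
  exact key

/-! ### The registered stub -/

/-- **STUB `stub_cellConcatenation` (line polyhedral_cell): concatenation of a `G`-cell along the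
zoom.** Given a `G`-cell `v` on the model period `[-1, -c⁻²]` (`c > 1`), the two-sided
ℤ-concatenation `u(t, x) = c⁻ᵏ v(c⁻²ᵏ t, c⁻ᵏ x)` for `t ∈ [-(c²)ᵏ, -(c²)ᵏ⁻¹]`, `k ∈ ℤ` (`u = 0`
for `t ≥ 0`) is, slab by slab, jointly continuous and Oseen-mild between all pairs of times of the
slab; its slices are weakly divergence free; it is exactly `c`-DSS, `G`-equivariant at every time,
has `u(-1) = v(-1)`, and obeys the Type-I time rate `‖u(t, x)‖ ≤ M/√(-t)` with the cell's bound `M`. -/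
theorem stub_cellConcatenation :
    ∀ (G : Subgroup (EuclideanSpace ℝ (Fin 3) ≃ₗᵢ[ℝ] EuclideanSpace ℝ (Fin 3))) (c : ℝ), 1 < c →
    ∀ v : ℝ → EuclideanSpace ℝ (Fin 3) → EuclideanSpace ℝ (Fin 3),
      (ContinuousOn (Function.uncurry v) (Set.Icc (-1 : ℝ) (-(c ^ 2)⁻¹) ×ˢ Set.univ) ∧
        (∃ M : ℝ, ∀ t ∈ Set.Icc (-1 : ℝ) (-(c ^ 2)⁻¹), ∀ x, ‖v t x‖ ≤ M) ∧
        (∀ t ∈ Set.Icc (-1 : ℝ) (-(c ^ 2)⁻¹), IsWeaklyDivFree (v t)) ∧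
        (∀ s t : ℝ, -1 ≤ s → s < t → t ≤ -(c ^ 2)⁻¹ → ∀ x,
          v t x = heatFlow (v s) (t - s) x - oseenDuhamel 1 s v v t x) ∧
        (∀ x, v (-(c ^ 2)⁻¹) x = c • v (-1) (c • x)) ∧
        (∀ g ∈ G, ∀ t ∈ Set.Icc (-1 : ℝ) (-(c ^ 2)⁻¹), ∀ x, v t (g x) = g (v t x))) →
      ∃ u : ℝ → EuclideanSpace ℝ (Fin 3) → EuclideanSpace ℝ (Fin 3),
        (∀ k : ℤ, ContinuousOn (Function.uncurry u)
          (Set.Icc (-((c ^ 2) ^ k)) (-((c ^ 2) ^ (k - 1))) ×ˢ Set.univ)) ∧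
        (∀ t < 0, IsWeaklyDivFree (u t)) ∧
        (∀ k : ℤ, ∀ s t : ℝ, -((c ^ 2) ^ k) ≤ s → s < t → t ≤ -((c ^ 2) ^ (k - 1)) → ∀ x,
          u t x = heatFlow (u s) (t - s) x - oseenDuhamel 1 s u u t x) ∧
        IsDiscretelySelfSimilar c u ∧
        (∀ g ∈ G, ∀ t x, u t (g x) = g (u t x)) ∧
        u (-1) = v (-1) ∧
        (∃ M : ℝ, HasTypeITimeDecay M u) := by
  intro G c hc v hcell
  obtain ⟨hvcont, ⟨M, hM⟩, hvdiv, hvmild, hjump, hveqv⟩ := hcell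
  have hc0 : 0 < c := one_pos.trans hc
  have hq : 1 < c ^ 2 := by nlinarith
  have hq0 : 0 < c ^ 2 := by positivity
  -- a slab index for every negative time
  have hex : ∀ t : ℝ, t < 0 → ∃ k : ℤ, (c ^ 2) ^ (k - 1) < -t ∧ -t ≤ (c ^ 2) ^ k :=
    fun t ht => exists_slabIdx hq ht
  choose! κ hκ using hex
  -- the concatenated field
  set u : ℝ → EuclideanSpace ℝ (Fin 3) → EuclideanSpace ℝ (Fin 3) := fun t x =>
    if t < 0 then c ^ (-κ t) • v ((c ^ (-κ t)) ^ 2 * t) (c ^ (-κ t) • x) else 0 with hu_def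
  have hslab : ∀ (k : ℤ) (t : ℝ), -((c ^ 2) ^ k) ≤ t → t ≤ -((c ^ 2) ^ (k - 1)) → ∀ x,
      u t x = c ^ (-k) • v ((c ^ (-k)) ^ 2 * t) (c ^ (-k) • x) :=
    fun k t h1 h2 x => concat_eq_zoom hc hjump hκ h1 h2 x
  have hzero : ∀ t : ℝ, ¬ t < 0 → ∀ x, u t x = 0 := fun t ht x => if_neg ht
  -- every negative time lies in its own slab
  have hmem : ∀ t < 0, -((c ^ 2) ^ (κ t)) ≤ t ∧ t ≤ -((c ^ 2) ^ (κ t - 1)) := fun t ht =>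
    ⟨by linarith [(hκ t ht).2], by linarith [(hκ t ht).1]⟩
  -- the model datum time `-1` and the sign of the bound
  have hone_mem : (-1 : ℝ) ∈ Icc (-1 : ℝ) (-(c ^ 2)⁻¹) :=
    ⟨le_rfl, neg_le_neg (inv_le_one_of_one_le₀ hq.le)⟩
  have hM0 : 0 ≤ M := (norm_nonneg _).trans (hM (-1) hone_mem 0)
  refine ⟨u, fun k => ?_, fun t ht => ?_, fun k s t hs hst ht x => ?_, ?_, fun g hg t x => ?_, ?_,
    ⟨M, fun t ht x => ?_⟩⟩
  · -- joint continuity on the slab `k`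
    exact (continuousOn_zoom_slab hc0 hvcont k).congr fun p hp => hslab k p.1 hp.1.1 hp.1.2 p.2
  · -- weakly divergence-free slices
    obtain ⟨h1, h2⟩ := hmem t ht
    have e : u t = fun x => c ^ (-κ t) • v ((c ^ (-κ t)) ^ 2 * t) (c ^ (-κ t) • x) :=
      funext fun x => hslab (κ t) t h1 h2 x
    rw [e]
    exact isWeaklyDivFree_zoom_in (hvdiv _ (zoom_time_mem hc0 (κ t) h1 h2)) (zoom_pos hc0 (κ t))
      (LinearIsometryEquiv.refl ℝ (EuclideanSpace ℝ (Fin 3)))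
  · -- the Oseen equation on the slab `k`
    have hus : u s = fun y => c ^ (-k) • v ((c ^ (-k)) ^ 2 * s) (c ^ (-k) • y) :=
      funext fun y => hslab k s hs (hst.le.trans ht) y
    have hD : oseenDuhamel 1 s u u t x =
        oseenDuhamel 1 s (fun τ y => c ^ (-k) • v ((c ^ (-k)) ^ 2 * τ) (c ^ (-k) • y))
          (fun τ y => c ^ (-k) • v ((c ^ (-k)) ^ 2 * τ) (c ^ (-k) • y)) t x :=
      oseenDuhamel_congr_Ioo
        (fun τ hτ => funext fun y => hslab k τ (hs.trans hτ.1.le) (hτ.2.le.trans ht) y)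
        (fun τ hτ => funext fun y => hslab k τ (hs.trans hτ.1.le) (hτ.2.le.trans ht) y) x
    rw [hslab k t (hs.trans hst.le) ht x, hus, hD]
    exact oseenMild_zoom_slab hc0 hvmild k hs hst ht x
  · -- exact discrete self-similarity `c • u (c² t) (c • x) = u t x`
    funext t x
    rw [nsRescale_apply]
    by_cases ht : t < 0
    · obtain ⟨h1, h2⟩ := hmem t ht
      have e1 : (c ^ 2) ^ (κ t - 1) * c ^ 2 = (c ^ 2) ^ (κ t) := by
        rw [zpow_sub_one₀ hq0.ne', inv_mul_cancel_right₀ hq0.ne']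
      have e2 : (c ^ 2) ^ (κ t) * c ^ 2 = (c ^ 2) ^ (κ t + 1) := by
        rw [zpow_add_one₀ hq0.ne']
      have h1' : -((c ^ 2) ^ (κ t + 1)) ≤ c ^ 2 * t := by
        have := mul_le_mul_of_nonneg_left h1 hq0.le
        calc -((c ^ 2) ^ (κ t + 1)) = c ^ 2 * (-((c ^ 2) ^ (κ t))) := by rw [← e2]; ring
          _ ≤ c ^ 2 * t := this
      have h2' : c ^ 2 * t ≤ -((c ^ 2) ^ (κ t + 1 - 1)) := by
        rw [add_sub_cancel_right]
        have := mul_le_mul_of_nonneg_left h2 hq0.le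
        calc c ^ 2 * t ≤ c ^ 2 * (-((c ^ 2) ^ (κ t - 1))) := this
          _ = -((c ^ 2) ^ (κ t)) := by rw [← e1]; ring
      have hb : c ^ (-(κ t + 1)) * c = c ^ (-κ t) := zoom_succ_mul hc0 (κ t)
      have e3 : (c ^ (-(κ t + 1))) ^ 2 * (c ^ 2 * t) = (c ^ (-(κ t + 1)) * c) ^ 2 * t := by ring
      rw [hslab (κ t + 1) (c ^ 2 * t) h1' h2' (c • x), hslab (κ t) t h1 h2 x, smul_smul, smul_smul,
        e3, mul_comm c (c ^ (-(κ t + 1))), hb]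
    · have ht' : ¬ c ^ 2 * t < 0 := by
        intro h
        apply ht
        by_contra h'
        push Not at h'
        have := mul_nonneg hq0.le h'
        linarith
      rw [hzero _ ht', hzero _ ht, smul_zero]
  · -- `G`-equivariance
    by_cases ht : t < 0
    · obtain ⟨h1, h2⟩ := hmem t ht
      rw [hslab (κ t) t h1 h2 (g x), hslab (κ t) t h1 h2 x, map_smul,
        ← hveqv g hg _ (zoom_time_mem hc0 (κ t) h1 h2) (c ^ (-κ t) • x), map_smul]
    · rw [hzero _ ht, hzero _ ht, map_zero]
  · -- the slice at `t = -1` is the cell's datum (slab `k = 0`)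
    funext x
    have h1 : -((c ^ 2) ^ (0 : ℤ)) ≤ (-1 : ℝ) := by rw [zpow_zero]
    have h2 : (-1 : ℝ) ≤ -((c ^ 2) ^ ((0 : ℤ) - 1)) := by
      rw [zero_sub, zpow_neg_one]
      exact neg_le_neg (inv_le_one_of_one_le₀ hq.le)
    rw [hslab 0 (-1) h1 h2 x, neg_zero, zpow_zero, one_smul, one_pow, one_mul, one_smul]
  · -- the Type-I time rate with the cell's bound
    obtain ⟨h1, h2⟩ := hmem t ht
    have hv : ‖v ((c ^ (-κ t)) ^ 2 * t) (c ^ (-κ t) • x)‖ ≤ M :=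
      hM _ (zoom_time_mem hc0 (κ t) h1 h2) _
    have hS : 0 < Real.sqrt ((c ^ 2) ^ (κ t)) := Real.sqrt_pos.2 (zpow_pos hq0 _)
    have hsq : Real.sqrt (-t) ≤ Real.sqrt ((c ^ 2) ^ (κ t)) := Real.sqrt_le_sqrt (by linarith)
    have hone := sqrt_zpow_sq_mul_zoom hc0 (κ t)
    have hspos : 0 < Real.sqrt (-t) := Real.sqrt_pos.2 (neg_pos.2 ht)
    rw [hslab (κ t) t h1 h2 x, norm_smul, Real.norm_of_nonneg (zoom_pos hc0 (κ t)).le]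
    calc c ^ (-κ t) * ‖v ((c ^ (-κ t)) ^ 2 * t) (c ^ (-κ t) • x)‖
        ≤ c ^ (-κ t) * M := mul_le_mul_of_nonneg_left hv (zoom_pos hc0 (κ t)).le
      _ = M / Real.sqrt ((c ^ 2) ^ (κ t)) := by
          rw [eq_div_iff hS.ne']
          calc c ^ (-κ t) * M * Real.sqrt ((c ^ 2) ^ (κ t))
              = M * (Real.sqrt ((c ^ 2) ^ (κ t)) * c ^ (-κ t)) := by ring
            _ = M := by rw [hone, mul_one]
      _ ≤ M / Real.sqrt (-t) := div_le_div_of_nonneg_left hM0 hspos hsq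

end Summit.NavierStokesRegularity.NavierStokesRegularity.Theorems.PolyhedralDssProfileExists.PolyhedralCell

end
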